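import Mathlib
import Summits.KontsevichZagierPeriods.KontsevichZagierPeriods.Theorems.SoloInformedPellAbelQuarterForm
import Summits.KontsevichZagierPeriods.KontsevichZagierPeriods.Theorems.SoloInformedPellAbelCircBand
import HarnessLib
import HarnessLib.Audit

/-!
# The quarter-turn Abel theorem for the third kind, II: dominations, semialgebraicity, integrability

For re circular Pell–Abel datum (`SoloInformedPellAbelQuarterForm`): the uniform lower bound of
`Dn = |γ_v|²` on `[0,1]²` and the bounds of the numerator `En = E₀ + κE₁` by compactness, whence
`|ψ| ≤ C(√(1−t))⁻¹` on `[0,1) × [0,1]` and `|Gq| ≤ C′(√(1−t))⁻¹`; the algebraicity of `α, β`;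
the `ℚ`-semialgebraicity of `ψ, φ, Φ` (in both coordinate orders, the null face `t = 1` of
the kill coordinates glued on); and the integrability of `ψ` on bands inside `(0,1) × [0,1]`.
-/

noncomputable section

open MeasureTheory Set Filter
open scoped Classical

open Literature.NumberTheory.Transcendental Literature.NumberTheory.Transcendental.KZ
open Literature.ModelTheory.ExponentialFields

namespace Summit.KontsevichZagierPeriods.KontsevichZagierPeriods.Theorems

namespace SoloInformedPellAbelQuarter

variable (P : SoloInformedPellAbelQuarter)

/-! ### Dominations (constants by compactness) -/

/-- A uniform lower bound `0 < d ≤ Dn` on `[0,1]²`. [this work] -/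
theorem exists_denom_ge : ∃ d : ℝ, 0 < d ∧ ∀ t ∈ Icc (0:ℝ) 1, ∀ v ∈ Icc (0:ℝ) 1, d ≤ P.Dn t v := by
  have hK : IsCompact (Icc (0:ℝ) 1 ×ˢ Icc (0:ℝ) 1) := isCompact_Icc.prod isCompact_Icc
  have hne : (Icc (0:ℝ) 1 ×ˢ Icc (0:ℝ) 1).Nonempty :=
    ⟨(0, 0), ⟨⟨le_rfl, zero_le_one⟩, ⟨le_rfl, zero_le_one⟩⟩⟩
  obtain ⟨p, hp, hmin⟩ := hK.exists_isMinOn hne P.continuous_Dn.continuousOn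
  exact ⟨P.Dn p.1 p.2, P.Dn_pos hp.1 hp.2, fun t ht v hv => (isMinOn_iff.1 hmin) (t, v) ⟨ht, hv⟩⟩

/-- `En` is affine in the kernel letter: `En(k) = En(0) + k(En(1) − En(0))`. [this work] -/
theorem En_affine (t v k : ℝ) : P.En t v k = P.En t v 0 + k * (P.En t v 1 - P.En t v 0) := by
  unfold En Nmv Nm dre Yd
  ring

/-- `(t,v) ↦ En(t,v,k)` is continuous. [folklore] -/
theorem continuous_En (k : ℝ) : Continuous fun p : ℝ × ℝ => P.En p.1 p.2 k := by
  obtain ⟨hC, hB, hW⟩ := P.continuous_CBW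
  have hC' := P.continuous_C'
  have hB' := P.continuous_B'
  unfold En Nmv Nm Dnv Dn re im dre dim Yd Y Wd a₂ b₂ a₂' b₂'
  fun_prop

/-- Uniform bounds of `En(·,·,0)` and `En(·,·,1) − En(·,·,0)` on `[0,1]²`. [this work] -/
theorem exists_En_le : ∃ C₀ C₁ : ℝ, 0 ≤ C₀ ∧ 0 ≤ C₁ ∧ ∀ t ∈ Icc (0:ℝ) 1, ∀ v ∈ Icc (0:ℝ) 1,
    |P.En t v 0| ≤ C₀ ∧ |P.En t v 1 - P.En t v 0| ≤ C₁ := by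
  have hK : IsCompact (Icc (0:ℝ) 1 ×ˢ Icc (0:ℝ) 1) := isCompact_Icc.prod isCompact_Icc
  have h0K : ((0:ℝ), (0:ℝ)) ∈ Icc (0:ℝ) 1 ×ˢ Icc (0:ℝ) 1 :=
    ⟨⟨le_rfl, zero_le_one⟩, ⟨le_rfl, zero_le_one⟩⟩
  have hc1 : Continuous fun p : ℝ × ℝ => P.En p.1 p.2 1 - P.En p.1 p.2 0 :=
    (P.continuous_En 1).sub (P.continuous_En 0)
  obtain ⟨C₀, hC₀⟩ := hK.exists_bound_of_continuousOn (P.continuous_En 0).continuousOn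
  obtain ⟨C₁, hC₁⟩ := hK.exists_bound_of_continuousOn hc1.continuousOn
  refine ⟨C₀, C₁, (norm_nonneg _).trans (hC₀ _ h0K), (norm_nonneg _).trans (hC₁ _ h0K),
    fun t ht v hv => ⟨?_, ?_⟩⟩
  · have h := hC₀ (t, v) ⟨ht, hv⟩
    rwa [Real.norm_eq_abs] at h
  · have h := hC₁ (t, v) ⟨ht, hv⟩
    rwa [Real.norm_eq_abs] at h

/-- `κ(t) ≤ (√(1−t))⁻¹(√(1−m))⁻¹` and `1 ≤ (√(1−t))⁻¹` on `[0,1)`. [folklore] -/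
theorem kq_le {t : ℝ} (ht : t ∈ Ico (0:ℝ) 1) :
    P.kq t ≤ (√(1 - t))⁻¹ * (√(1 - P.m))⁻¹ ∧ 1 ≤ (√(1 - t))⁻¹ ∧ 0 ≤ P.kq t := by
  refine ⟨soloInformed_kummerZeta_kappa_le P.m_mem ht, ?_, by unfold kq; positivity⟩
  have h1 : 0 < √(1 - t) := Real.sqrt_pos.2 (by linarith [ht.2])
  have h2 : √(1 - t) ≤ 1 := by
    calc √(1 - t) ≤ √1 := Real.sqrt_le_sqrt (by linarith [ht.1])
      _ = 1 := Real.sqrt_one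
  exact (one_le_inv₀ h1).2 h2

/-- **Domination of the 2-form**: `|ψ(t,v)| ≤ C(√(1−t))⁻¹` on `[0,1) × [0,1]`. [this work] -/
theorem exists_om_abs_le : ∃ C : ℝ, 0 ≤ C ∧ ∀ p ∈ Ico (0:ℝ) 1 ×ˢ Icc (0:ℝ) 1,
    |P.om p.1 p.2| ≤ C * (√(1 - p.1))⁻¹ := by
  obtain ⟨d, hd, hdle⟩ := P.exists_denom_ge
  obtain ⟨C₀, C₁, hC₀, hC₁, hC⟩ := P.exists_En_le
  have hm := P.m_mem
  have hr : 0 ≤ (√(1 - P.m))⁻¹ := by positivity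
  refine ⟨(C₀ + C₁ * (√(1 - P.m))⁻¹) / d ^ 2, by positivity, fun p hp => ?_⟩
  obtain ⟨t, v⟩ := p
  obtain ⟨ht, hv⟩ : t ∈ Ico (0:ℝ) 1 ∧ v ∈ Icc (0:ℝ) 1 := hp
  have ht' : t ∈ Icc (0:ℝ) 1 := ⟨ht.1, ht.2.le⟩
  obtain ⟨hκ, hs, hκ0⟩ := P.kq_le ht
  have hs0 : 0 ≤ (√(1 - t))⁻¹ := by positivity
  have hD := P.Dn_pos ht' hv
  have hDge := hdle t ht' v hv
  obtain ⟨hE0, hE1⟩ := hC t ht' v hv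
  set s := (√(1 - t))⁻¹ with hsdef
  set r := (√(1 - P.m))⁻¹ with hrdef
  have hD2 : d ^ 2 ≤ P.Dn t v ^ 2 := pow_le_pow_left₀ hd.le hDge 2
  have hnum : |P.En t v (P.kq t)| ≤ C₀ * s + s * r * C₁ := by
    rw [P.En_affine]
    calc |P.En t v 0 + P.kq t * (P.En t v 1 - P.En t v 0)|
        ≤ |P.En t v 0| + P.kq t * |P.En t v 1 - P.En t v 0| := by
          refine (abs_add_le _ _).trans (add_le_add le_rfl ?_)
          rw [abs_mul, abs_of_nonneg hκ0]
      _ ≤ C₀ + P.kq t * C₁ := add_le_add hE0 (mul_le_mul_of_nonneg_left hE1 hκ0)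
      _ ≤ C₀ * s + s * r * C₁ := by nlinarith [mul_le_mul_of_nonneg_right hκ hC₁]
  rw [P.om_eq ht.2]
  unfold omCore
  rw [abs_div, abs_of_pos (pow_pos hD 2)]
  calc |P.En t v (P.kq t)| / P.Dn t v ^ 2 ≤ (C₀ * s + s * r * C₁) / P.Dn t v ^ 2 :=
        div_le_div_of_nonneg_right hnum (pow_pos hD 2).le
    _ ≤ (C₀ * s + s * r * C₁) / d ^ 2 :=
        div_le_div_of_nonneg_left (by positivity) (pow_pos hd 2) hD2
    _ = (C₀ + C₁ * r) / d ^ 2 * s := by ring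

/-- `(1−nt²)⁻¹ ≤ (1−n)⁻¹ + 1` on `t² ≤ 1` (either sign of `n < 1`). [folklore] -/
theorem inv_denom_le {t : ℝ} (ht : t ^ 2 ≤ 1) : (1 - P.n * t ^ 2)⁻¹ ≤ (1 - P.n)⁻¹ + 1 := by
  have h1n : 0 < 1 - P.n := by linarith [P.n_lt]
  have hD := P.one_sub_n_pos ht
  rcases le_or_gt 0 P.n with hn | hn
  · have hDge : 1 - P.n ≤ 1 - P.n * t ^ 2 := by nlinarith [mul_le_mul_of_nonneg_left ht hn]
    exact (inv_anti₀ h1n hDge).trans (le_add_of_nonneg_right zero_le_one)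
  · have hDge : (1:ℝ) ≤ 1 - P.n * t ^ 2 := by nlinarith [mul_nonneg (neg_nonneg.2 hn.le) (sq_nonneg t)]
    exact (inv_le_one_of_one_le₀ hDge).trans (le_add_of_nonneg_left (inv_pos.2 h1n).le)

/-- The constant of `|(q₀+q₂t²)κ/(1−nt²)| ≤ C′(√(1−t))⁻¹`. [this work] -/
def CGq : ℝ := (|P.q₀| + |P.q₂|) * ((1 - P.n)⁻¹ + 1) * (√(1 - P.m))⁻¹

/-- **Domination of the end**: `0 ≤ C′` and `|Gq(t)| ≤ C′(√(1−t))⁻¹` on `[0,1)`. [this work] -/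
theorem Gq_abs_le {t : ℝ} (ht : t ∈ Ico (0:ℝ) 1) : 0 ≤ P.CGq ∧ |P.Gq t| ≤ P.CGq * (√(1 - t))⁻¹ := by
  have h1n : 0 < 1 - P.n := by linarith [P.n_lt]
  refine ⟨by unfold CGq; positivity, ?_⟩
  have ht2 : t ^ 2 < 1 := by nlinarith [ht.1, ht.2]
  have hq : |P.q₀ + P.q₂ * t ^ 2| ≤ |P.q₀| + |P.q₂| := by
    refine (abs_add_le _ _).trans (add_le_add le_rfl ?_)
    rw [abs_mul, abs_of_nonneg (sq_nonneg t)]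
    exact mul_le_of_le_one_right (abs_nonneg _) ht2.le
  have hq0 : 0 ≤ |P.q₀| + |P.q₂| := by positivity
  obtain ⟨hκ, -, hκ0⟩ := P.kq_le ht
  have hb0 : 0 ≤ (√(1 - t))⁻¹ * (√(1 - P.m))⁻¹ := by positivity
  have hD : 0 < 1 - P.n * t ^ 2 := P.one_sub_n_pos ht2.le
  have hi := P.inv_denom_le ht2.le
  unfold Gq CGq
  rw [abs_div, abs_mul, abs_of_nonneg hκ0, abs_of_pos hD, div_eq_mul_inv]
  calc |P.q₀ + P.q₂ * t ^ 2| * P.kq t * (1 - P.n * t ^ 2)⁻¹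
      ≤ (|P.q₀| + |P.q₂|) * ((√(1 - t))⁻¹ * (√(1 - P.m))⁻¹) * ((1 - P.n)⁻¹ + 1) :=
        mul_le_mul (mul_le_mul hq hκ hκ0 hq0) hi (inv_pos.2 hD).le (mul_nonneg hq0 hb0)
    _ = _ := by ring

/-! ### The constants are algebraic -/

/-- `α`, `2β` and `β` are algebraic. [folklore] -/
theorem alpha_beta_isAlgebraic :
    IsAlgebraic ℚ P.alpha ∧ IsAlgebraic ℚ (2 * P.beta) ∧ IsAlgebraic ℚ P.beta := by
  have hn : P.n ∈ algebraicClosure ℚ ℝ := mem_algebraicClosure_iff.2 P.n_isAlgebraic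
  have h0 : P.q₀ ∈ algebraicClosure ℚ ℝ := mem_algebraicClosure_iff.2 P.q₀_isAlgebraic
  have h2 : P.q₂ ∈ algebraicClosure ℚ ℝ := mem_algebraicClosure_iff.2 P.q₂_isAlgebraic
  have h02 : (2:ℝ) ∈ algebraicClosure ℚ ℝ := by exact_mod_cast natCast_mem (algebraicClosure ℚ ℝ) 2
  refine ⟨mem_algebraicClosure_iff.1 ?_, mem_algebraicClosure_iff.1 ?_, mem_algebraicClosure_iff.1 ?_⟩
  · unfold alpha; apply_rules (transparency := .reducible) (maxDepth := 250) only
      [div_mem, mul_mem, add_mem, hn, h0, h2]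
  · unfold beta; apply_rules (transparency := .reducible) (maxDepth := 250) only
      [div_mem, mul_mem, add_mem, hn, h0, h2, h02]
  · unfold beta; apply_rules (transparency := .reducible) (maxDepth := 250) only
      [div_mem, mul_mem, add_mem, hn, h0, h2]

/-! ### Semialgebraicity -/

/-- The model polynomials `a₂, a₂′, b₂, b₂′` of `wᵢ` are `ℚ`-semialgebraic. [folklore] -/
theorem sa_model {S : Set (Fin 2 → ℝ)} (hS : IsSemialgebraic ℚ S) (i : Fin 2) :
    IsSemialgebraicFunOn ℚ S (fun w => a₂ (w i)) ∧ IsSemialgebraicFunOn ℚ S (fun w => a₂' (w i)) ∧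
    IsSemialgebraicFunOn ℚ S (fun w => b₂ (w i)) ∧ IsSemialgebraicFunOn ℚ S (fun w => b₂' (w i)) := by
  have ht : IsSemialgebraicFunOn ℚ S (fun w => w i) := Literature.NumberTheory.Transcendental.isSemialgebraicFunOn_apply hS i
  have h2 : IsAlgebraic ℚ (2:ℝ) := by exact_mod_cast isAlgebraic_nat (R := ℚ) (A := ℝ) 2
  have c2 : IsSemialgebraicFunOn ℚ S (fun _ => (2:ℝ)) := isSemialgebraicFunOn_const_of_isAlgebraic hS h2
  have c2n : IsSemialgebraicFunOn ℚ S (fun _ => (-2:ℝ)) :=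
    isSemialgebraicFunOn_const_of_isAlgebraic hS h2.neg
  have q1 := SoloInformedPellAbel.sa_quad hS isAlgebraic_one isAlgebraic_one.neg i
  refine ⟨q1.congr fun w _ => ?_, (IsSemialgebraicFunOn.mul_holds c2n ht).congr fun w _ => ?_,
    (IsSemialgebraicFunOn.mul_holds c2 ht).congr fun w _ => ?_, c2.congr fun w _ => ?_⟩
  · simp only [a₂]; ring
  · simp only [Pi.mul_apply, a₂']; ring
  · simp only [Pi.mul_apply, b₂]
  · simp only [b₂']

/-- **Semialgebraicity of `ω_core, ϑ, Θ`** in the coordinates `t = wᵢ ∈ [0,1)`, `v = wⱼ ∈ [0,1]`.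
[this work] -/
theorem sa_three {S : Set (Fin 2 → ℝ)} (hS : IsSemialgebraic ℚ S) (i j : Fin 2)
    (hi : ∀ w ∈ S, w i ∈ Ico (0:ℝ) 1) (hj : ∀ w ∈ S, w j ∈ Icc (0:ℝ) 1) :
    IsSemialgebraicFunOn ℚ S (fun w => P.omCore (w i) (w j)) ∧
    IsSemialgebraicFunOn ℚ S (fun w => P.vth (w i) (w j)) ∧
    IsSemialgebraicFunOn ℚ S (fun w => P.Th (w i) (w j)) := by
  have hm := P.m_mem
  have hma := P.m_isAlgebraic
  have hC := P.sa_C hS i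
  have hC' := P.sa_C' hS i
  have hB := P.sa_B hS i
  have hB' := P.sa_B' hS i
  obtain ⟨ha₀, ha₀', hb₀, hb₀'⟩ := sa_model hS i
  obtain ⟨hκ, hW⟩ := SoloInformedPellAbel.sa_kernel hS hm hma i
    fun w hw => ⟨by linarith [(hi w hw).1], (hi w hw).2⟩
  have ht : IsSemialgebraicFunOn ℚ S (fun w => w i) := Literature.NumberTheory.Transcendental.isSemialgebraicFunOn_apply hS i
  have hv : IsSemialgebraicFunOn ℚ S (fun w => w j) := Literature.NumberTheory.Transcendental.isSemialgebraicFunOn_apply hS j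
  have h1 : IsSemialgebraicFunOn ℚ S (fun _ => (1:ℝ)) :=
    isSemialgebraicFunOn_const_of_isAlgebraic hS isAlgebraic_one
  have h2 : IsSemialgebraicFunOn ℚ S (fun _ => (2:ℝ)) :=
    isSemialgebraicFunOn_const_of_isAlgebraic hS (by exact_mod_cast isAlgebraic_nat (R := ℚ) (A := ℝ) 2)
  have h1v := IsSemialgebraicFunOn.sub_holds h1 hv
  have h2a : IsAlgebraic ℚ (2:ℝ) := by exact_mod_cast isAlgebraic_nat (R := ℚ) (A := ℝ) 2
  have hq := SoloInformedPellAbel.sa_quad hS (isAlgebraic_one.add hma).neg (h2a.mul hma) i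
  have hkap : IsSemialgebraicFunOn ℚ S (fun w => P.kq (w i)) := hκ.congr fun w _ => by
    simp only [kq]
  have hX : IsSemialgebraicFunOn ℚ S (fun w => P.Y (w i)) :=
    (IsSemialgebraicFunOn.mul_holds hC hW).congr fun w _ => by simp only [Pi.mul_apply, Y]
  have hWd : IsSemialgebraicFunOn ℚ S (fun w => P.Wd (w i)) :=
    (IsSemialgebraicFunOn.mul_holds ht hq).congr fun w _ => by
      simp only [Pi.mul_apply, Wd]; ring
  have hXd : IsSemialgebraicFunOn ℚ S (fun w => P.Yd (w i) (P.kq (w i))) :=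
    (IsSemialgebraicFunOn.add_holds (IsSemialgebraicFunOn.mul_holds hC' hW)
      (IsSemialgebraicFunOn.mul_holds hC (IsSemialgebraicFunOn.mul_holds hWd hkap))).congr
      fun w _ => by simp only [Pi.add_apply, Pi.mul_apply, Yd]
  have ha : IsSemialgebraicFunOn ℚ S (fun w => P.re (w i) (w j)) :=
    (IsSemialgebraicFunOn.add_holds (IsSemialgebraicFunOn.mul_holds h1v ha₀)
      (IsSemialgebraicFunOn.mul_holds hv hX)).congr fun w _ => by
      simp only [Pi.add_apply, Pi.mul_apply, Pi.sub_apply, re]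
  have hda : IsSemialgebraicFunOn ℚ S (fun w => P.dre (w i) (w j) (P.kq (w i))) :=
    (IsSemialgebraicFunOn.add_holds (IsSemialgebraicFunOn.mul_holds h1v ha₀')
      (IsSemialgebraicFunOn.mul_holds hv hXd)).congr fun w _ => by
      simp only [Pi.add_apply, Pi.mul_apply, Pi.sub_apply, dre]
  have hb : IsSemialgebraicFunOn ℚ S (fun w => P.im (w i) (w j)) :=
    (IsSemialgebraicFunOn.add_holds (IsSemialgebraicFunOn.mul_holds h1v hb₀)
      (IsSemialgebraicFunOn.mul_holds hv hB)).congr fun w _ => by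
      simp only [Pi.add_apply, Pi.mul_apply, Pi.sub_apply, im]
  have hdb : IsSemialgebraicFunOn ℚ S (fun w => P.dim (w i) (w j)) :=
    (IsSemialgebraicFunOn.add_holds (IsSemialgebraicFunOn.mul_holds h1v hb₀')
      (IsSemialgebraicFunOn.mul_holds hv hB')).congr fun w _ => by
      simp only [Pi.add_apply, Pi.mul_apply, Pi.sub_apply, dim]
  have hD : IsSemialgebraicFunOn ℚ S (fun w => P.Dn (w i) (w j)) :=
    (IsSemialgebraicFunOn.add_holds (IsSemialgebraicFunOn.mul_holds ha ha)
      (IsSemialgebraicFunOn.mul_holds hb hb)).congr fun w _ => by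
      simp only [Pi.add_apply, Pi.mul_apply, Dn]
  have hN : IsSemialgebraicFunOn ℚ S (fun w => P.Nm (w i) (w j) (P.kq (w i))) :=
    (IsSemialgebraicFunOn.sub_holds (IsSemialgebraicFunOn.mul_holds ha hdb)
      (IsSemialgebraicFunOn.mul_holds hb hda)).congr fun w _ => by
      simp only [Pi.sub_apply, Pi.mul_apply, Nm]
  have hNv : IsSemialgebraicFunOn ℚ S (fun w => P.Nmv (w i) (w j) (P.kq (w i))) :=
    (IsSemialgebraicFunOn.sub_holds
      (IsSemialgebraicFunOn.add_holds
        (IsSemialgebraicFunOn.mul_holds (IsSemialgebraicFunOn.sub_holds hX ha₀) hdb)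
        (IsSemialgebraicFunOn.mul_holds ha (IsSemialgebraicFunOn.sub_holds hB' hb₀')))
      (IsSemialgebraicFunOn.add_holds
        (IsSemialgebraicFunOn.mul_holds (IsSemialgebraicFunOn.sub_holds hB hb₀) hda)
        (IsSemialgebraicFunOn.mul_holds hb (IsSemialgebraicFunOn.sub_holds hXd ha₀')))).congr
      fun w _ => by simp only [Pi.sub_apply, Pi.add_apply, Pi.mul_apply, Nmv]
  have hDv : IsSemialgebraicFunOn ℚ S (fun w => P.Dnv (w i) (w j)) :=
    (IsSemialgebraicFunOn.add_holds
      (IsSemialgebraicFunOn.mul_holds (IsSemialgebraicFunOn.mul_holds h2 ha)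
        (IsSemialgebraicFunOn.sub_holds hX ha₀))
      (IsSemialgebraicFunOn.mul_holds (IsSemialgebraicFunOn.mul_holds h2 hb)
        (IsSemialgebraicFunOn.sub_holds hB hb₀))).congr fun w _ => by
      simp only [Pi.add_apply, Pi.sub_apply, Pi.mul_apply, Dnv]
  have hE : IsSemialgebraicFunOn ℚ S (fun w => P.En (w i) (w j) (P.kq (w i))) :=
    (IsSemialgebraicFunOn.sub_holds (IsSemialgebraicFunOn.mul_holds hNv hD)
      (IsSemialgebraicFunOn.mul_holds hN hDv)).congr fun w _ => by
      simp only [Pi.sub_apply, Pi.mul_apply, En]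
  have hM : IsSemialgebraicFunOn ℚ S (fun w => a₂ (w i) * P.B (w i) - P.Y (w i) * b₂ (w i)) :=
    (IsSemialgebraicFunOn.sub_holds (IsSemialgebraicFunOn.mul_holds ha₀ hB)
      (IsSemialgebraicFunOn.mul_holds hX hb₀)).congr fun w _ => by
      simp only [Pi.sub_apply, Pi.mul_apply]
  have hDpos : ∀ w ∈ S, P.Dn (w i) (w j) ≠ 0 := fun w hw =>
    (P.Dn_pos ⟨(hi w hw).1, (hi w hw).2.le⟩ (hj w hw)).ne'
  have hDD : ∀ w ∈ S, P.Dn (w i) (w j) * P.Dn (w i) (w j) ≠ 0 := fun w hw =>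
    mul_ne_zero (hDpos w hw) (hDpos w hw)
  refine ⟨(IsSemialgebraicFunOn.mul_holds hE ((IsSemialgebraicFunOn.mul_holds hD hD).inv hDD)).congr
      fun w _ => ?_,
    (IsSemialgebraicFunOn.mul_holds hM (hD.inv hDpos)).congr fun w _ => ?_,
    (IsSemialgebraicFunOn.mul_holds hN (hD.inv hDpos)).congr fun w _ => ?_⟩
  · simp only [Pi.mul_apply, omCore, div_eq_mul_inv, pow_two]
  · simp only [Pi.mul_apply, vth, div_eq_mul_inv]
  · simp only [Pi.mul_apply, Th, div_eq_mul_inv]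

/-- **Kill coordinates with the face glued on**: `ψ(w₁, w₀)` and `φ(w₁, w₀)` are
`ℚ`-semialgebraic on `S ⊆ {0 ≤ w₁ ≤ 1, w₀ ∈ [0,1]}` (both vanish on `w₁ = 1`). [this work] -/
theorem sa_swap_face {S : Set (Fin 2 → ℝ)} (hS : IsSemialgebraic ℚ S)
    (hw : ∀ w ∈ S, w 1 ∈ Icc (0:ℝ) 1 ∧ w 0 ∈ Icc (0:ℝ) 1) :
    IsSemialgebraicFunOn ℚ S (fun w => P.vth (w 1) (w 0)) ∧
    IsSemialgebraicFunOn ℚ S (fun w => P.om (w 1) (w 0)) := by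
  have hS' := hS.inter (isSemialgebraic_setOf_apply_lt_const (n := 2) isAlgebraic_one 1)
  obtain ⟨hP, hQ, -⟩ := P.sa_three hS' 1 0
    (fun w hw' => ⟨(hw w hw'.1).1.1, hw'.2⟩) fun w hw' => (hw w hw'.1).2
  have hP' : IsSemialgebraicFunOn ℚ (S ∩ {w | w 1 < 1}) (fun w => P.om (w 1) (w 0)) :=
    hP.congr fun w hw' => by
      have h : w 1 < 1 := hw'.2
      simp only [P.om_eq h]
  exact ⟨soloInformed_kummerZeta_sa_face hS hQ (fun w _ hw1 => by
      rw [hw1]; exact (P.faces (w 0)).2.1) fun w hwS => (hw w hwS).1.2,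
    soloInformed_kummerZeta_sa_face hS hP' (fun w _ hw1 => by
      rw [hw1]; exact (P.faces (w 0)).2.2) fun w hwS => (hw w hwS).1.2⟩

/-- Deformation coordinates: `ψ(w₀, w₁)` and `Φ(w₀, w₁)` are `ℚ`-semialgebraic on
`S ⊆ {w₀ ∈ [0,1), w₁ ∈ [0,1]}`. [this work] -/
theorem sa_deform {S : Set (Fin 2 → ℝ)} (hS : IsSemialgebraic ℚ S)
    (hw : ∀ w ∈ S, w 0 ∈ Ico (0:ℝ) 1 ∧ w 1 ∈ Icc (0:ℝ) 1) :
    IsSemialgebraicFunOn ℚ S (fun w => P.om (w 0) (w 1)) ∧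
    IsSemialgebraicFunOn ℚ S (fun w => P.Th (w 0) (w 1)) := by
  obtain ⟨hP, -, hF⟩ := P.sa_three hS 0 1 (fun w hwS => (hw w hwS).1) fun w hwS => (hw w hwS).2
  exact ⟨hP.congr fun w hwS => by simp only [P.om_eq (hw w hwS).1.2], hF⟩

/-! ### Integrability of the 2-form on bands inside `(0,1) × [0,1]` -/

/-- `ψ(w₀, w₁)` and `ψ(w₁, w₀)` are integrable on every semialgebraic `S ⊆ (0,1) × [0,1]`
(deformation and kill coordinates). [this work] -/
theorem integrableOn_om {S : Set (Fin 2 → ℝ)} (hS : IsSemialgebraic ℚ S)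
    (hw : ∀ w ∈ S, w 0 ∈ Ioo (0:ℝ) 1 ∧ w 1 ∈ Icc (0:ℝ) 1) :
    IntegrableOn (fun w : Fin 2 → ℝ => P.om (w 0) (w 1)) S ∧
    IntegrableOn (fun w : Fin 2 → ℝ => P.om (w 1) (w 0)) S := by
  have hg := (P.sa_deform hS fun w hwS => ⟨⟨(hw w hwS).1.1.le, (hw w hwS).1.2⟩, (hw w hwS).2⟩).1
  have hg' := (P.sa_swap_face hS fun w hwS =>
    ⟨(hw w hwS).2, ⟨(hw w hwS).1.1.le, (hw w hwS).1.2.le⟩⟩).2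
  obtain ⟨C, hC, hCle⟩ := P.exists_om_abs_le
  have hZ : volume ({w : Fin 2 → ℝ | w 1 = 0} ∪ {w | w 1 = 1}) = 0 :=
    measure_union_null (by rw [volume_pi]; exact Measure.pi_hyperplane _ 1 0)
      (by rw [volume_pi]; exact Measure.pi_hyperplane _ 1 1)
  have hcube : ∀ w ∈ S, w ∉ ({w : Fin 2 → ℝ | w 1 = 0} ∪ {w | w 1 = 1}) →
      ∀ j : Fin 2, w j ∈ Ioo (0:ℝ) 1 := by
    intro w hwS hZ' j
    simp only [mem_union, mem_setOf_eq, not_or] at hZ'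
    fin_cases j
    · exact (hw w hwS).1
    · exact ⟨lt_of_le_of_ne (hw w hwS).2.1 (Ne.symm hZ'.1), lt_of_le_of_ne (hw w hwS).2.2 hZ'.2⟩
  refine ⟨soloInformed_integrableOn_of_le_inv_sqrt_prod hS hg ∅ {0} ∅ {0} C _ hZ hcube
      fun w _ hc => ?_,
    soloInformed_integrableOn_of_le_inv_sqrt_prod hS hg' ∅ {1} ∅ {1} C _ hZ hcube
      fun w _ hc => ?_⟩
  · have ha := hc 0
    have hb := hc 1
    have hK := hCle (w 0, w 1) ⟨⟨ha.1.le, ha.2⟩, ⟨hb.1.le, hb.2.le⟩⟩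
    have hX : 0 ≤ (√(1 - w 0))⁻¹ := by positivity
    rw [Finset.prod_empty, Finset.prod_singleton, one_mul]
    calc |P.om (w 0) (w 1)| ≤ C * (√(1 - w 0))⁻¹ := hK
      _ ≤ C * ((√(1 - w 0))⁻¹ + (√(1 - w 0))⁻¹) := by nlinarith [mul_nonneg hC hX]
  · have ha := hc 0
    have hb := hc 1
    have hK := hCle (w 1, w 0) ⟨⟨hb.1.le, hb.2⟩, ⟨ha.1.le, ha.2.le⟩⟩
    have hX : 0 ≤ (√(1 - w 1))⁻¹ := by positivity
    rw [Finset.prod_empty, Finset.prod_singleton, one_mul]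
    calc |P.om (w 1) (w 0)| ≤ C * (√(1 - w 1))⁻¹ := hK
      _ ≤ C * ((√(1 - w 1))⁻¹ + (√(1 - w 1))⁻¹) := by nlinarith [mul_nonneg hC hX]

end SoloInformedPellAbelQuarter

end Summit.KontsevichZagierPeriods.KontsevichZagierPeriods.Theorems

end
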